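import Mathlib.Analysis.Calculus.ContDiff.Bounds
import Literature.Geometry.Lorentzian.DecaySymbols
import HarnessLib

/-!
# Smooth symbols at infinity, II: linear images, derivatives, reciprocals, inverse matrices

Continuation of `DecaySymbols.lean` (the `O_k(r^a)` calculus `IsBigOSmooth k a f` of smooth
symbols on the chart of an asymptotically flat end; all results proved). The rules added here
are the ones behind *"`ds²_t = ds² + t Ric` is asymptotically flat by (1.2)"* (Schoen–Yau, Comm.
Math. Phys. 65 (1979), p. 73), where the chart components of `Ric` are rational expressions in the
metric components, their first and second derivatives and the inverse Gram matrix: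

* `IsBigOSmooth.clm_comp_left`, `clm_apply_const` — continuous linear images and evaluation of
  operator-valued symbols (`‖∂^m (L ∘ f)‖ ≤ ‖L‖ ‖∂^m f‖`);
* `IsBigOSmooth.fderiv`, `fderiv_apply_const` — **the derivative rule** `O_{k+1}(r^a) → O_k(r^{a-1})`
  (`‖∂^m Df‖ = ‖∂^{m+1} f‖`), i.e. Schoen–Yau's (1.1) "`∂hᵢⱼ = O(r⁻³)`, `∂∂hᵢⱼ = O(r⁻⁴)`";
* `isBigOSmooth_zero`, `IsBigOSmooth.finset_sum`, `finset_prod₀` — finite sums and products;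
* `IsBigOSmooth.inv` — **the reciprocal rule**: `f ∈ O_k(1)`, `f → 1` at infinity ⟹ `1/f ∈ O_k(1)`
  (Faà di Bruno bound `norm_iteratedFDerivWithin_comp_le`: `‖∂^m f⁻¹‖ ≤ m! C (C'/r)^m`);
* `isBigOSmooth_matrix_det`, `isBigOSmooth_matrix_adjugate`, `isBigOSmooth_matrix_inv` — matrices
  of symbols: the inverse of `δ + O_k` with `det → 1` has `O_k(1)` entries (the inverse metric
  `g^{ij}` of an asymptotically flat end).

## References

* R. Schoen, S.-T. Yau, *On the proof of the positive mass conjecture in general relativity*,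
  Comm. Math. Phys. 65 (1979) 45–76, §1 (1.1)–(1.2), §3 p. 73.
* R. Bartnik, *The mass of an asymptotically flat manifold*, CPAM 39 (1986), §1, Def. 2.1.
-/

noncomputable section

open Set Filter Asymptotics Bornology Topology
open scoped ContDiff

namespace Literature.Geometry.Lorentzian

namespace IsBigOSmooth

variable {E : Type*} [NormedAddCommGroup E] [NormedSpace ℝ E]
  {W : Type*} [NormedAddCommGroup W] [NormedSpace ℝ W]
  {W' : Type*} [NormedAddCommGroup W'] [NormedSpace ℝ W']
  {k : ℕ} {a : ℝ}

/-- **Continuous linear images of symbols**: if `f ∈ O_k(r^a)` and `L` is a continuous linear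
map then `L ∘ f ∈ O_k(r^a)` (`‖∂^m (L ∘ f)‖ ≤ ‖L‖ ‖∂^m f‖`, Mathlib's
`ContinuousLinearMap.norm_iteratedFDeriv_comp_left`). [folklore] -/
theorem clm_comp_left {f : E → W} (hf : IsBigOSmooth k a f) (L : W →L[ℝ] W') :
    IsBigOSmooth k a fun y ↦ L (f y) := by
  obtain ⟨R₁, hR₁⟩ := hf.eventually_contDiffAt
  refine ⟨?_, fun m hm ↦ ?_⟩
  · obtain ⟨R₀, hR₀⟩ := hf.1
    exact ⟨R₀, L.contDiff.comp_contDiffOn hR₀⟩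
  · have H : ∀ᶠ x in cobounded E, ‖iteratedFDeriv ℝ m (fun y ↦ L (f y)) x‖ ≤
        ‖L‖ * ‖iteratedFDeriv ℝ m f x‖ := by
      filter_upwards [eventually_cobounded_lt_norm (E := E) R₁] with x hx
      exact L.norm_iteratedFDeriv_comp_left (hR₁ x hx) (natCast_le_infty m)
    exact (IsBigO.of_norm_eventuallyLE
      (H.mono fun x hx ↦ (Real.norm_of_nonneg (norm_nonneg _)).trans_le hx)).trans
      ((hf.isBigO hm).const_mul_left ‖L‖)

/-- **Evaluation of operator-valued symbols on a fixed vector**: if `F ∈ O_k(r^a)` takes values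
in `W →L W'` then `y ↦ F(y) v ∈ O_k(r^a)`. [folklore] -/
theorem clm_apply_const {F : E → W →L[ℝ] W'} (hF : IsBigOSmooth k a F) (v : W) :
    IsBigOSmooth k a fun y ↦ F y v :=
  hF.clm_comp_left (ContinuousLinearMap.apply ℝ W' v)

/-- **Derivatives of symbols**: if `f ∈ O_{k+1}(r^a)` then `Df ∈ O_k(r^{a-1})` (as a map into
`E →L W`; `‖∂^m Df‖ = ‖∂^{m+1} f‖`, Mathlib's `norm_iteratedFDeriv_fderiv`). This is the rule
"`∂hᵢⱼ = O(r⁻³)`, `∂∂hᵢⱼ = O(r⁻⁴)`" of Schoen–Yau 1979, (1.1). [cite: SchoenYauPMT1979, §1 (1.1)] -/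
theorem fderiv {f : E → W} (hf : IsBigOSmooth (k + 1) a f) :
    IsBigOSmooth k (a - 1) (fderiv ℝ f) := by
  refine ⟨?_, fun m hm ↦ ?_⟩
  · obtain ⟨R₀, hR₀⟩ := hf.1
    exact ⟨R₀, (hR₀.fderiv_of_isOpen (isOpen_setOf_lt_norm R₀) le_rfl)⟩
  · have h := hf.isBigO (m := m + 1) (by omega)
    have H : ∀ x : E, ‖iteratedFDeriv ℝ m (_root_.fderiv ℝ f) x‖ ≤
        ‖iteratedFDeriv ℝ (m + 1) f x‖ := fun x ↦ norm_iteratedFDeriv_fderiv.le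
    refine (IsBigO.of_norm_eventuallyLE (Eventually.of_forall fun x ↦
      (Real.norm_of_nonneg (norm_nonneg _)).trans_le (H x))).trans
      (h.trans (EventuallyEq.isBigO (Eventually.of_forall fun x ↦ ?_)))
    push_cast
    ring_nf

/-- **Directional derivatives of symbols**: if `f ∈ O_{k+1}(r^a)` then `y ↦ Df(y) v ∈ O_k(r^{a-1})`.
[folklore] -/
theorem fderiv_apply_const {f : E → W} (hf : IsBigOSmooth (k + 1) a f) (v : E) :
    IsBigOSmooth k (a - 1) fun y ↦ _root_.fderiv ℝ f y v :=
  hf.fderiv.clm_apply_const v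

end IsBigOSmooth

section Zero

variable {E : Type*} [NormedAddCommGroup E] [NormedSpace ℝ E]
  {W : Type*} [NormedAddCommGroup W] [NormedSpace ℝ W]

/-- **The zero function is a symbol of every order.** [folklore] -/
theorem isBigOSmooth_zero (k : ℕ) (a : ℝ) : IsBigOSmooth k a fun _ : E ↦ (0 : W) := by
  refine ⟨⟨0, contDiffOn_const⟩, fun m _ ↦ ?_⟩
  refine IsBigO.of_bound 0 (Eventually.of_forall fun x ↦ ?_)
  have h : iteratedFDeriv ℝ m (fun _ : E ↦ (0 : W)) x = 0 := by simp
  simp [h]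

end Zero

namespace IsBigOSmooth

variable {E : Type*} [NormedAddCommGroup E] [NormedSpace ℝ E]
  {W : Type*} [NormedAddCommGroup W] [NormedSpace ℝ W]
  {k : ℕ} {a : ℝ}

/-- **Finite sums of symbols.** [folklore] -/
theorem finset_sum {ι : Type*} (s : Finset ι) {f : ι → E → W}
    (hf : ∀ i ∈ s, IsBigOSmooth k a (f i)) : IsBigOSmooth k a fun y ↦ ∑ i ∈ s, f i y := by
  classical
  induction s using Finset.induction_on with
  | empty =>
    simpa only [Finset.sum_empty] using isBigOSmooth_zero (E := E) (W := W) k a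
  | insert i s hi ih =>
    have h := (hf i (Finset.mem_insert_self i s)).add
      (ih fun j hj ↦ hf j (Finset.mem_insert_of_mem hj))
    exact h.congr fun y ↦ (Finset.sum_insert (f := fun j ↦ f j y) hi).symm

/-- **Finite products of scalar symbols of order `0`.** [folklore] -/
theorem finset_prod₀ {ι : Type*} (s : Finset ι) {f : ι → E → ℝ}
    (hf : ∀ i ∈ s, IsBigOSmooth k 0 (f i)) : IsBigOSmooth k 0 fun y ↦ ∏ i ∈ s, f i y := by
  classical
  induction s using Finset.induction_on with
  | empty =>
    simpa only [Finset.prod_empty] using isBigOSmooth_const (E := E) k (1 : ℝ)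
  | insert i s hi ih =>
    have h := (hf i (Finset.mem_insert_self i s)).mul₀
      (ih fun j hj ↦ hf j (Finset.mem_insert_of_mem hj))
    exact h.congr fun y ↦ (Finset.prod_insert (f := fun j ↦ f j y) hi).symm

omit [NormedSpace ℝ E] in
/-- Extraction of a radius from an eventual statement along `Bornology.cobounded`. [folklore] -/
theorem _root_.Literature.Geometry.Lorentzian.exists_radius_of_eventually_cobounded
    {P : E → Prop} (h : ∀ᶠ x in cobounded E, P x) : ∃ R : ℝ, ∀ x : E, R < ‖x‖ → P x := by
  obtain ⟨R, -, hR⟩ := (Metric.hasBasis_cobounded_compl_closedBall (0 : E)).eventually_iff.1 h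
  exact ⟨R, fun x hx ↦ hR (by simpa using hx)⟩

/-- **Reciprocals of symbols tending to `1`.** If `f ∈ O_k(1)` is a scalar symbol with `f → 1`
at infinity, then `1/f ∈ O_k(1)`: by Faà di Bruno in the form of Mathlib's
`norm_iteratedFDerivWithin_comp_le`, `‖∂^m (f⁻¹)(x)‖ ≤ m! · C · (C' ‖x‖⁻¹)^m` with `C` a bound
for the derivatives of `z ↦ z⁻¹` on `[1/2, 3/2]` and `‖∂^i f(x)‖ ≤ (C' ‖x‖⁻¹)^i` for
`1 ≤ i ≤ m` (from `‖∂^i f‖ = O(r^{-i})`). This is the step `det(h_ij)⁻¹ = 1 + O_k(r^{-a})`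
behind the inverse metric of an asymptotically flat end. [folklore] -/
theorem inv {f : E → ℝ} (hf : IsBigOSmooth k 0 f) (h1 : Tendsto f (cobounded E) (𝓝 1)) :
    IsBigOSmooth k 0 fun y ↦ (f y)⁻¹ := by
  -- a far region on which `f` is smooth and takes values in `(1/2, 3/2)`
  obtain ⟨R₀, hR₀⟩ := hf.1
  have hval : ∀ᶠ x in cobounded E, f x ∈ Ioo (1 / 2 : ℝ) (3 / 2) :=
    h1 (Ioo_mem_nhds (by norm_num) (by norm_num))
  obtain ⟨R₁, hR₁⟩ := exists_radius_of_eventually_cobounded hval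
  set s : Set E := {y | max R₀ R₁ < ‖y‖} with hs_def
  have hs : IsOpen s := isOpen_setOf_lt_norm _
  have hfs : ContDiffOn ℝ ∞ f s := hR₀.mono (setOf_lt_norm_anti (le_max_left _ _))
  have hfval : ∀ y ∈ s, f y ∈ Ioo (1 / 2 : ℝ) (3 / 2) := fun y hy ↦
    hR₁ y (lt_of_le_of_lt (le_max_right _ _) hy)
  have hfne : ∀ y ∈ s, f y ≠ 0 := fun y hy ↦ by
    have := (hfval y hy).1
    positivity
  refine ⟨⟨max R₀ R₁, hfs.inv hfne⟩, fun m hm ↦ ?_⟩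
  -- bounds for the derivatives of `z ↦ z⁻¹` on `[1/2, 3/2]`
  set t : Set ℝ := Ioo (1 / 4 : ℝ) 2 with ht_def
  have ht : IsOpen t := isOpen_Ioo
  have hginv : ContDiffOn ℝ ∞ (Inv.inv : ℝ → ℝ) t :=
    (contDiffOn_inv ℝ (𝕜' := ℝ)).mono fun z hz h0 ↦ by
      have hz1 : (1 / 4 : ℝ) < z := hz.1
      rw [mem_singleton_iff.1 h0] at hz1
      norm_num at hz1
  have hK : IsCompact (Icc (1 / 2 : ℝ) (3 / 2)) := isCompact_Icc
  have hKt : Icc (1 / 2 : ℝ) (3 / 2) ⊆ t := fun z hz ↦ ⟨by linarith [hz.1], by linarith [hz.2]⟩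
  have hCi : ∀ i : ℕ, ∃ C : ℝ, ∀ z ∈ Icc (1 / 2 : ℝ) (3 / 2),
      ‖iteratedFDerivWithin ℝ i (Inv.inv : ℝ → ℝ) t z‖ ≤ C := fun i ↦
    hK.exists_bound_of_continuousOn
      ((hginv.continuousOn_iteratedFDerivWithin (natCast_le_infty i) ht.uniqueDiffOn).mono hKt)
  choose C hC using hCi
  set Cm : ℝ := ∑ i ∈ Finset.range (m + 1), |C i| with hCm
  have hCm_bound : ∀ i, i ≤ m → ∀ z ∈ Icc (1 / 2 : ℝ) (3 / 2),
      ‖iteratedFDerivWithin ℝ i (Inv.inv : ℝ → ℝ) t z‖ ≤ Cm := by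
    intro i hi z hz
    refine ((hC i z hz).trans (le_abs_self _)).trans ?_
    exact Finset.single_le_sum (f := fun i ↦ |C i|) (fun _ _ ↦ abs_nonneg _)
      (Finset.mem_range.2 (Nat.lt_succ_of_le hi))
  -- bounds `‖∂^i f(x)‖ ≤ (C' ‖x‖⁻¹)^i` for `1 ≤ i ≤ m`, eventually
  have hci : ∀ i ∈ Finset.range (m + 1), ∃ c : ℝ, 0 < c ∧ ∀ᶠ x in cobounded E,
      ‖iteratedFDeriv ℝ i f x‖ ≤ c * ‖x‖ ^ (-(i : ℝ)) := by
    intro i hi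
    have him : i ≤ k := (Nat.lt_succ_iff.1 (Finset.mem_range.1 hi)).trans hm
    obtain ⟨c, hc, h⟩ := (hf.isBigO him).exists_pos
    refine ⟨c, hc, ?_⟩
    filter_upwards [h.bound, eventually_cobounded_lt_norm (E := E) 0] with x hx hx0
    rw [norm_norm, Real.norm_of_nonneg (Real.rpow_nonneg (norm_nonneg _) _), zero_sub] at hx
    exact hx
  choose! c hc0 hc using hci
  set C' : ℝ := 1 + ∑ i ∈ Finset.range (m + 1), c i with hC'
  have hcsum : ∀ i ∈ Finset.range (m + 1), c i ≤ ∑ j ∈ Finset.range (m + 1), c j := fun i hi ↦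
    Finset.single_le_sum (f := c) (fun j hj ↦ (hc0 j hj).le) hi
  have hC'1 : 1 ≤ C' := by
    have : 0 ≤ ∑ j ∈ Finset.range (m + 1), c j := Finset.sum_nonneg fun j hj ↦ (hc0 j hj).le
    linarith
  have hall : ∀ᶠ x in cobounded E, ∀ i ∈ Finset.range (m + 1),
      ‖iteratedFDeriv ℝ i f x‖ ≤ c i * ‖x‖ ^ (-(i : ℝ)) :=
    (Finset.eventually_all _).2 fun i hi ↦ hc i hi
  -- the estimate on the far region
  have H : ∀ᶠ x in cobounded E, ‖iteratedFDeriv ℝ m (fun y ↦ (f y)⁻¹) x‖ ≤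
      (m.factorial * Cm * C' ^ m) * ‖x‖ ^ ((0 : ℝ) - m) := by
    filter_upwards [hall, eventually_cobounded_lt_norm (E := E) (max R₀ R₁),
      eventually_cobounded_le_norm (E := E) 1] with x hx hxs hx1
    have hxpos : 0 < ‖x‖ := by linarith
    have hxs' : x ∈ s := hxs
    have hD : ∀ i, 1 ≤ i → i ≤ m → ‖iteratedFDerivWithin ℝ i f s x‖ ≤ (C' * ‖x‖⁻¹) ^ i := by
      intro i hi1 him
      have hi : i ∈ Finset.range (m + 1) := Finset.mem_range.2 (Nat.lt_succ_of_le him)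
      rw [iteratedFDerivWithin_of_isOpen i hs hxs']
      calc ‖iteratedFDeriv ℝ i f x‖ ≤ c i * ‖x‖ ^ (-(i : ℝ)) := hx i hi
        _ ≤ C' ^ i * ‖x‖ ^ (-(i : ℝ)) := by
            gcongr
            calc c i ≤ C' := by linarith [hcsum i hi]
              _ ≤ C' ^ i := le_self_pow₀ hC'1 (by omega)
        _ = (C' * ‖x‖⁻¹) ^ i := by
            rw [mul_pow, Real.rpow_neg hxpos.le, Real.rpow_natCast, inv_pow]
    have hCb : ∀ i, i ≤ m → ‖iteratedFDerivWithin ℝ i (Inv.inv : ℝ → ℝ) t (f x)‖ ≤ Cm :=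
      fun i hi ↦ hCm_bound i hi (f x) ⟨(hfval x hxs').1.le, (hfval x hxs').2.le⟩
    have hmaps : MapsTo f s t := fun y hy ↦ ⟨by linarith [(hfval y hy).1], by
      linarith [(hfval y hy).2]⟩
    have key := norm_iteratedFDerivWithin_comp_le (g := (Inv.inv : ℝ → ℝ)) (f := f) (n := m)
      hginv hfs (natCast_le_infty m) ht.uniqueDiffOn hs.uniqueDiffOn hmaps hxs' hCb hD
    rw [iteratedFDerivWithin_of_isOpen m hs hxs'] at key
    calc ‖iteratedFDeriv ℝ m (fun y ↦ (f y)⁻¹) x‖ = ‖iteratedFDeriv ℝ m (Inv.inv ∘ f) x‖ := rfl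
      _ ≤ m.factorial * Cm * (C' * ‖x‖⁻¹) ^ m := key
      _ = (m.factorial * Cm * C' ^ m) * ‖x‖ ^ ((0 : ℝ) - m) := by
          rw [mul_pow, zero_sub, Real.rpow_neg hxpos.le, Real.rpow_natCast, inv_pow]
          ring
  exact (IsBigO.of_norm_eventuallyLE
    (H.mono fun x hx ↦ (Real.norm_of_nonneg (norm_nonneg _)).trans_le hx)).trans
    ((isBigO_refl _ _).const_mul_left _)

end IsBigOSmooth

/-! ### Matrices of symbols: determinant, adjugate, inverse -/

section Matrix

variable {E : Type*} [NormedAddCommGroup E] [NormedSpace ℝ E] {k : ℕ}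
  {ι : Type*} [Fintype ι] [DecidableEq ι] {A : E → Matrix ι ι ℝ}

/-- **The determinant of a matrix of symbols of order `0` is a symbol of order `0`** (Leibniz
expansion, Mathlib's `Matrix.det_apply'`). [folklore] -/
theorem isBigOSmooth_matrix_det (hA : ∀ i j, IsBigOSmooth k 0 fun y ↦ A y i j) :
    IsBigOSmooth k 0 fun y ↦ (A y).det := by
  have h : IsBigOSmooth k 0 fun y ↦
      ∑ σ : Equiv.Perm ι, (Equiv.Perm.sign σ : ℝ) * ∏ i, A y (σ i) i :=
    IsBigOSmooth.finset_sum _ fun σ _ ↦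
      (IsBigOSmooth.finset_prod₀ _ fun i _ ↦ hA (σ i) i).const_mul _
  exact h.congr fun y ↦ (Matrix.det_apply' (A y)).symm

/-- The entries of the adjugate of a matrix of symbols of order `0` are symbols of order `0`
(each is a determinant, `Matrix.adjugate_apply`). [folklore] -/
theorem isBigOSmooth_matrix_adjugate (hA : ∀ i j, IsBigOSmooth k 0 fun y ↦ A y i j) (i j : ι) :
    IsBigOSmooth k 0 fun y ↦ (A y).adjugate i j := by
  have h : IsBigOSmooth k 0 fun y ↦ ((A y).updateRow j (Pi.single i 1)).det := by
    refine isBigOSmooth_matrix_det (A := fun y ↦ (A y).updateRow j (Pi.single i 1)) fun i' j' ↦ ?_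
    by_cases h : i' = j
    · simp only [h, Matrix.updateRow_self]
      exact isBigOSmooth_const k _
    · simp only [Matrix.updateRow_ne h]
      exact hA i' j'
  exact h.congr fun y ↦ (Matrix.adjugate_apply (A y) i j).symm

/-- **The inverse of a matrix of symbols of order `0` with determinant tending to `1` has entries
which are symbols of order `0`** (`A⁻¹ = (det A)⁻¹ • adj A`, `IsBigOSmooth.inv`). This is the
inverse metric `g^{ij} = δ^{ij} + O_k(r^{-a})` of an asymptotically flat end (Schoen–Yau 1979,
p. 47; Bartnik 1986, §1). [folklore] -/
theorem isBigOSmooth_matrix_inv (hA : ∀ i j, IsBigOSmooth k 0 fun y ↦ A y i j)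
    (hdet : Tendsto (fun y ↦ (A y).det) (cobounded E) (𝓝 1)) (i j : ι) :
    IsBigOSmooth k 0 fun y ↦ (A y)⁻¹ i j := by
  have h := ((isBigOSmooth_matrix_det hA).inv hdet).mul₀ (isBigOSmooth_matrix_adjugate hA i j)
  refine h.congr fun y ↦ ?_
  rw [Matrix.inv_def, Matrix.smul_apply, smul_eq_mul, Ring.inverse_eq_inv']

end Matrix

end Literature.Geometry.Lorentzian

end
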